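import Mathlib

/-!
# Stub `stub_gradedElimination` for `FreeSubtorus.OrbitDimensionBound`, line `Sketch`

Graded Gaussian elimination.  Rows of a square complex matrix `X` carry integer weights `wr`,
columns carry weights `wc`, and `X` is *graded of degree `0`*: `X i j ≠ 0 → wr i = wc j`.
Then there are invertible *graded* matrices `P` (`P i i' ≠ 0 → wr i = wr i'`) and `Q`
(`Q j j' ≠ 0 → wc j = wc j'`) such that `P * X * Q` is a partial permutation `0/1` matrix:
its entries lie in `{0, 1}` and each row and each column has at most one non-zero entry.

Proof: the elementary pivot step at a non-zero entry `(i₀, j₀)` (scale row `i₀`, clear column `j₀`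
by row operations, then clear row `i₀` by column operations) is performed by the graded invertible
matrix `1 + C`, `C` supported on column `i₀` (explicit inverse of the same shape), and by the
transpose of the analogous matrix for `(P * X)ᵀ`.  After the step the entry `(i₀, j₀)` is an
*isolated `1`* (the rest of its row and column vanishes), previously isolated `1`s stay isolated,
zero rows stay zero, and gradedness is preserved.  An induction over a finset `S` of rows
containing all rows that are not yet "zero or isolated" finishes the proof.
-/

set_option linter.dupNamespace false

namespace Summit.ValiantsHypothesis.ValiantsHypothesis.Theorems.FreeSubtorusOrbitDimensionBound

/-- The product of two graded matrices is graded: if `A i j ≠ 0 → f i = g j` and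
`B j k ≠ 0 → g j = h k` then `(A * B) i k ≠ 0 → f i = h k`. [folklore] -/
theorem gradedElimination_graded_mul {ι κ μ : Type*} [Fintype κ] {f : ι → ℤ} {g : κ → ℤ}
    {h : μ → ℤ} {A : Matrix ι κ ℂ} {B : Matrix κ μ ℂ}
    (hA : ∀ i j, A i j ≠ 0 → f i = g j) (hB : ∀ j k, B j k ≠ 0 → g j = h k) :
    ∀ i k, (A * B) i k ≠ 0 → f i = h k := by
  intro i k hik
  by_contra hne
  apply hik
  rw [Matrix.mul_apply]
  refine Finset.sum_eq_zero fun j _ => ?_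
  by_cases hAij : A i j = 0
  · rw [hAij, zero_mul]
  by_cases hBjk : B j k = 0
  · rw [hBjk, mul_zero]
  exact absurd ((hA i j hAij).trans (hB j k hBjk)) hne

/-- Left multiplication by `1 + C`, where `C` is supported on the column `i₀` with entries `c`,
adds `c i` times row `i₀` to row `i`. [folklore] -/
theorem gradedElimination_colOp_mul_apply {ι κ : Type*} [Fintype ι] [DecidableEq ι]
    (i₀ : ι) (c : ι → ℂ) (M : Matrix ι κ ℂ) (i : ι) (j : κ) :
    (((1 : Matrix ι ι ℂ) + Matrix.of fun a b : ι => if b = i₀ then c a else 0) * M) i j =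
      M i j + c i * M i₀ j := by
  rw [Matrix.add_mul, Matrix.one_mul, Matrix.add_apply, Matrix.mul_apply]
  simp only [Matrix.of_apply, ite_mul, zero_mul, Finset.sum_ite_eq', Finset.mem_univ, if_true]

/-- The graded row step: if `X i₀ j₀ ≠ 0` there is an invertible matrix `P`, graded for the row
weights, such that `P * X` has row `i₀` divided by `X i₀ j₀` and column `j₀` cleared outside
row `i₀`. [folklore] -/
theorem gradedElimination_rowStep {ι κ : Type*} [Fintype ι] [DecidableEq ι] [Fintype κ]
    (wr : ι → ℤ) (wc : κ → ℤ) (X : Matrix ι κ ℂ) (hX : ∀ i j, X i j ≠ 0 → wr i = wc j)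
    (i₀ : ι) (j₀ : κ) (hx : X i₀ j₀ ≠ 0) :
    ∃ P : Matrix ι ι ℂ, IsUnit P ∧ (∀ i i', P i i' ≠ 0 → wr i = wr i') ∧
      P * X = Matrix.of (fun i j => if i = i₀ then X i₀ j / X i₀ j₀
        else X i j - X i j₀ * X i₀ j / X i₀ j₀) := by
  set x := X i₀ j₀ with hxdef
  -- the column of coefficients of the row operation and of its inverse
  set c : ι → ℂ := fun a => if a = i₀ then x⁻¹ - 1 else -(X a j₀ / x) with hcdef
  set c' : ι → ℂ := fun a => if a = i₀ then x - 1 else X a j₀ with hc'def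
  set P : Matrix ι ι ℂ := (1 : Matrix ι ι ℂ) + Matrix.of fun a b : ι => if b = i₀ then c a else 0
    with hPdef
  set P' : Matrix ι ι ℂ := (1 : Matrix ι ι ℂ) + Matrix.of fun a b : ι => if b = i₀ then c' a else 0
    with hP'def
  have hPP' : P * P' = 1 := by
    ext i k
    rw [hPdef, gradedElimination_colOp_mul_apply, hP'def]
    simp only [Matrix.add_apply, Matrix.of_apply, Matrix.one_apply, hcdef, hc'def]
    by_cases hk : k = i₀
    · by_cases hi : i = i₀
      · simp only [hk, hi, if_true]
        field_simp
        ring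
      · simp only [hk, hi, if_true, if_false]
        field_simp
        ring
    · simp [hk, Ne.symm hk]
  refine ⟨P, IsUnit.of_mul_eq_one P' hPP', ?_, ?_⟩
  · -- gradedness of `P`
    intro i i' h
    by_contra hne
    have hii' : i ≠ i' := fun e => hne (congrArg wr e)
    by_cases hi' : i' = i₀
    · have hi : i ≠ i₀ := fun e => hii' (e.trans hi'.symm)
      have hXi : X i j₀ ≠ 0 := by
        intro h0
        apply h
        simp [hPdef, hcdef, hi', hi, h0]
      exact hne (by rw [hX i j₀ hXi, hi', hX i₀ j₀ hx])
    · apply h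
      simp [hPdef, hii', hi']
  · -- the entries of `P * X`
    ext i j
    rw [hPdef, gradedElimination_colOp_mul_apply, Matrix.of_apply, hcdef]
    by_cases hi : i = i₀
    · simp only [hi, if_true]
      rw [div_eq_mul_inv]
      ring
    · simp only [hi, if_false]
      ring

/-- The graded pivot step: if `X i₀ j₀ ≠ 0` there are invertible graded matrices `P`, `Q` such
that `P * X * Q` has an isolated `1` at `(i₀, j₀)` (row `i₀` and column `j₀` vanish elsewhere)
and entries `X i j - X i j₀ * X i₀ j / X i₀ j₀` off row `i₀` and column `j₀`. [folklore] -/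
theorem gradedElimination_pivotStep {ι κ : Type*} [Fintype ι] [DecidableEq ι] [Fintype κ]
    [DecidableEq κ] (wr : ι → ℤ) (wc : κ → ℤ) (X : Matrix ι κ ℂ)
    (hX : ∀ i j, X i j ≠ 0 → wr i = wc j) (i₀ : ι) (j₀ : κ) (hx : X i₀ j₀ ≠ 0) :
    ∃ (P : Matrix ι ι ℂ) (Q : Matrix κ κ ℂ), IsUnit P ∧ IsUnit Q ∧
      (∀ i i', P i i' ≠ 0 → wr i = wr i') ∧ (∀ j j', Q j j' ≠ 0 → wc j = wc j') ∧
      P * X * Q = Matrix.of (fun i j => if i = i₀ then (if j = j₀ then (1 : ℂ) else 0)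
        else if j = j₀ then 0 else X i j - X i j₀ * X i₀ j / X i₀ j₀) := by
  obtain ⟨P, hPu, hPg, hPX⟩ := gradedElimination_rowStep wr wc X hX i₀ j₀ hx
  -- entries of `Y := P * X`
  have hY : ∀ i j, (P * X) i j =
      if i = i₀ then X i₀ j / X i₀ j₀ else X i j - X i j₀ * X i₀ j / X i₀ j₀ := by
    intro i j
    rw [hPX, Matrix.of_apply]
  have hY₀ : ∀ i, (P * X) i j₀ = if i = i₀ then 1 else 0 := by
    intro i
    rw [hY]
    split_ifs with hi
    · exact div_self hx
    · rw [mul_div_assoc, div_self hx, mul_one, sub_self]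
  have hY1 : (P * X) i₀ j₀ = 1 := by rw [hY₀, if_pos rfl]
  have hYg : ∀ i j, (P * X) i j ≠ 0 → wr i = wc j := gradedElimination_graded_mul hPg hX
  obtain ⟨Q, hQu, hQg, hQY⟩ := gradedElimination_rowStep wc wr (P * X).transpose
    (fun j i h => (hYg i j h).symm) j₀ i₀ (by rw [Matrix.transpose_apply, hY1]; exact one_ne_zero)
  refine ⟨P, Q.transpose, hPu, (Matrix.isUnit_transpose Q).mpr hQu, hPg,
    fun j j' h => (hQg j' j h).symm, ?_⟩
  have hT : P * X * Q.transpose = (Q * (P * X).transpose).transpose := by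
    rw [Matrix.transpose_mul, Matrix.transpose_transpose]
  rw [hT, hQY]
  ext i j
  simp only [Matrix.transpose_apply, Matrix.of_apply, hY1, div_one]
  rw [hY₀ i]
  by_cases hi : i = i₀ <;> by_cases hj : j = j₀ <;> simp [hi, hj, hY]

/-- The induction behind graded elimination: if every row outside the finset `S` is already
"clean" (each of its non-zero entries is an isolated `1`), then graded invertible row and column
operations make *every* row clean. [folklore] -/
theorem gradedElimination_aux {ι κ : Type*} [Fintype ι] [DecidableEq ι] [Fintype κ]
    [DecidableEq κ] (wr : ι → ℤ) (wc : κ → ℤ) (S : Finset ι) :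
    ∀ X : Matrix ι κ ℂ, (∀ i j, X i j ≠ 0 → wr i = wc j) →
      (∀ i, i ∉ S → ∀ j, X i j ≠ 0 →
        X i j = 1 ∧ (∀ j', j' ≠ j → X i j' = 0) ∧ (∀ i', i' ≠ i → X i' j = 0)) →
      ∃ (P : Matrix ι ι ℂ) (Q : Matrix κ κ ℂ), IsUnit P ∧ IsUnit Q ∧
        (∀ i i', P i i' ≠ 0 → wr i = wr i') ∧ (∀ j j', Q j j' ≠ 0 → wc j = wc j') ∧
        (∀ i j, (P * X * Q) i j ≠ 0 → (P * X * Q) i j = 1 ∧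
          (∀ j', j' ≠ j → (P * X * Q) i j' = 0) ∧ (∀ i', i' ≠ i → (P * X * Q) i' j = 0)) := by
  induction S using Finset.induction_on with
  | empty =>
    intro X hX hgood
    refine ⟨1, 1, isUnit_one, isUnit_one, ?_, ?_, ?_⟩
    · intro i i' h
      have : i = i' := by
        by_contra hne
        exact h (Matrix.one_apply_ne hne)
      rw [this]
    · intro j j' h
      have : j = j' := by
        by_contra hne
        exact h (Matrix.one_apply_ne hne)
      rw [this]
    · simpa only [Matrix.one_mul, Matrix.mul_one] using
        fun i => hgood i (Finset.notMem_empty i)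
  | insert i₀ S hi₀ ih =>
    intro X hX hgood
    by_cases hrow : ¬ ∃ j, X i₀ j ≠ 0
    · -- row `i₀` vanishes: nothing to do for it
      refine ih X hX ?_
      intro i hi j hij
      by_cases hii : i = i₀
      · rw [hii] at hij
        exact absurd ⟨j, hij⟩ hrow
      · exact hgood i (fun h => (Finset.mem_insert.mp h).elim hii hi) j hij
    · rw [not_not] at hrow
      obtain ⟨j₀, hx⟩ := hrow
      obtain ⟨P₁, Q₁, hP₁u, hQ₁u, hP₁g, hQ₁g, hPXQ⟩ :=
        gradedElimination_pivotStep wr wc X hX i₀ j₀ hx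
      -- the entries of the pivoted matrix `X' := P₁ * X * Q₁`
      have hX' : ∀ i j, (P₁ * X * Q₁) i j = if i = i₀ then (if j = j₀ then (1 : ℂ) else 0)
          else if j = j₀ then 0 else X i j - X i j₀ * X i₀ j / X i₀ j₀ := by
        intro i j
        rw [hPXQ, Matrix.of_apply]
      -- `X'` is graded
      have hX'g : ∀ i j, (P₁ * X * Q₁) i j ≠ 0 → wr i = wc j :=
        gradedElimination_graded_mul (gradedElimination_graded_mul hP₁g hX) hQ₁g
      -- rows outside `S` are clean in `X'`
      have hgood' : ∀ i, i ∉ S → ∀ j, (P₁ * X * Q₁) i j ≠ 0 → (P₁ * X * Q₁) i j = 1 ∧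
          (∀ j', j' ≠ j → (P₁ * X * Q₁) i j' = 0) ∧
          (∀ i', i' ≠ i → (P₁ * X * Q₁) i' j = 0) := by
        intro i hi j hij
        by_cases hii : i = i₀
        · -- the pivot row
          rw [hii] at hij ⊢
          have hjj : j = j₀ := by
            by_contra hjj
            apply hij
            simp [hX', hjj]
          refine ⟨by simp [hX', hjj], fun j' hj' => ?_, fun i' hi' => ?_⟩
          · rw [hjj] at hj'
            simp [hX', hj']
          · simp [hX', hi', hjj]
        · -- a row outside `insert i₀ S`: clean in `X`, hence clean in `X'`
          have hgi := hgood i (fun h => (Finset.mem_insert.mp h).elim hii hi)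
          have hjj : j ≠ j₀ := by
            intro hjj
            apply hij
            simp [hX', hii, hjj]
          have hXij₀ : X i j₀ = 0 := by
            by_contra h0
            exact hx ((hgi j₀ h0).2.2 i₀ (Ne.symm hii))
          have hXij : X i j ≠ 0 := by
            intro h0
            apply hij
            simp [hX', hii, hjj, hXij₀, h0]
          obtain ⟨h1, hr, hc⟩ := hgi j hXij
          refine ⟨by simp [hX', hii, hjj, hXij₀, h1], fun j' hj' => ?_, fun i' hi' => ?_⟩
          · by_cases hj'₀ : j' = j₀
            · simp [hX', hii, hj'₀]
            · simp [hX', hii, hj'₀, hXij₀, hr j' hj']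
          · by_cases hi'₀ : i' = i₀
            · simp [hX', hi'₀, hjj]
            · simp [hX', hi'₀, hjj, hc i' hi', hc i₀ (Ne.symm hii)]
      obtain ⟨P, Q, hPu, hQu, hPg, hQg, hPQ⟩ := ih (P₁ * X * Q₁) hX'g hgood'
      refine ⟨P * P₁, Q₁ * Q, hPu.mul hP₁u, hQ₁u.mul hQu, gradedElimination_graded_mul hPg hP₁g,
        gradedElimination_graded_mul hQ₁g hQg, ?_⟩
      have hassoc : P * P₁ * X * (Q₁ * Q) = P * (P₁ * X * Q₁) * Q := by
        simp only [Matrix.mul_assoc]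
      rw [hassoc]
      exact hPQ

/-- **Stub `stub_gradedElimination`** (graded Gaussian elimination).  If the rows of a square
complex matrix `X` carry integer weights `wr`, the columns weights `wc`, and `X i j ≠ 0` only when
`wr i = wc j`, then there are invertible matrices `P`, `Q`, graded in the sense
`P i i' ≠ 0 → wr i = wr i'`, `Q j j' ≠ 0 → wc j = wc j'`, such that `P * X * Q` is a partial
permutation `0/1` matrix: entries in `{0, 1}`, at most one non-zero entry in each row and in each
column. [folklore] -/
theorem stub_gradedElimination :
    ∀ {m : ℕ} (wr wc : Fin m → ℤ) (X : Matrix (Fin m) (Fin m) ℂ),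
      (∀ i j, X i j ≠ 0 → wr i = wc j) →
      ∃ (P Q : Matrix (Fin m) (Fin m) ℂ), IsUnit P ∧ IsUnit Q ∧
        (∀ i i', P i i' ≠ 0 → wr i = wr i') ∧ (∀ j j', Q j j' ≠ 0 → wc j = wc j') ∧
        (∀ i j, (P * X * Q) i j = 0 ∨ (P * X * Q) i j = 1) ∧
        (∀ i j j', (P * X * Q) i j ≠ 0 → (P * X * Q) i j' ≠ 0 → j = j') ∧
        (∀ i i' j, (P * X * Q) i j ≠ 0 → (P * X * Q) i' j ≠ 0 → i = i') := by
  intro m wr wc X hX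
  obtain ⟨P, Q, hPu, hQu, hPg, hQg, hgood⟩ := gradedElimination_aux wr wc
    (Finset.univ : Finset (Fin m)) X hX (fun i hi => absurd (Finset.mem_univ i) hi)
  refine ⟨P, Q, hPu, hQu, hPg, hQg, ?_, ?_, ?_⟩
  · intro i j
    by_cases h : (P * X * Q) i j = 0
    · exact Or.inl h
    · exact Or.inr (hgood i j h).1
  · intro i j j' h h'
    by_contra hne
    exact h' ((hgood i j h).2.1 j' (Ne.symm hne))
  · intro i i' j h h'
    by_contra hne
    exact h' ((hgood i j h).2.2 i' (Ne.symm hne))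

end Summit.ValiantsHypothesis.ValiantsHypothesis.Theorems.FreeSubtorusOrbitDimensionBound
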